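import Literature.NumberTheory.GaloisCohomology.Howard2004.TowerSelmerLiftGlobalDualityProofs
import Literature.NumberTheory.GaloisCohomology.Howard2004.DVRSettingLevelConditionsCocartesianProofs
import Literature.NumberTheory.GaloisCohomology.Howard2004.DVRSettingLevelConditionsCartesianProofs
import Literature.NumberTheory.GaloisCohomology.Howard2004.KolyvaginSystemScalars
import Literature.NumberTheory.GaloisCohomology.PairingTateDual
import Literature.NumberTheory.GaloisRepresentations.ContinuousCupProductCompat
import Literature.NumberTheory.GaloisRepresentations.GaloisCohomologyScalarAction
import HarnessLib

/-!
# Howard 2004, Prop. 1.4.1 on a `DVRSetting`, CLASS-LEVEL: the pairing of the level sequence is `R`-BALANCED —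
# `P(r·a, y) = P(a, rᴰ·y)` for the scalar action `H¹(r•)` and its transpose on the Tate dual (brick «C451-CL Q2b = BAL»)

Topic `NumberTheory/GaloisCohomology/Howard2004` (cell `pub/bsd-print-x9`; LEAD `bsd-line-x10b-p1` g14's class-level port «C451-CL» of
the Flach leaf C45.1″; seat `bsd-line-x10b-p1-w2` g18; sequel of `TowerCasselsTatePairingOfDefectsProofs` (Q2: the pairing `P`
DEFINED by the Poitou–Tate value on local defects, characterised by its VALUE CLAUSE `hP`, which is all this file uses)).
THEOREMS ONLY: no definition, no named fact, no instance, no notation, no `sorry`.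

SOURCE.  B. Howard, *The Heegner point Kolyvagin system*, Compositio Math. **140** (2004) = arXiv:1202.6340, Prop. 1.4.1 and the
proof of Thm. 1.4.2 (p. 8 L108–120: «a nondegenerate pairing of `R/𝔪`-vector spaces» — the pairing is `R`-bilinear: cup product
with `R(1)`-coefficients); Def. 1.1.1 (p. 5 L20–21: local conditions are `R`-submodules).  In the class-level port the pairing is
valued in `ℤ/n₀` through the evaluation pairing `N_0 × N_0^∨(1) → μ_{n₀}`, for which the scalar `r` on `N_0` and the
PRECOMPOSITION `rᴰ : f ↦ f ∘ (r•)` on `N_0^∨(1)` are adjoint; `R`-bilinearity becomes `R`-BALANCE `P(r·a, y) = P(a, rᴰ·y)` (the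
shape `hQ` of x10b-p1-w7's ZMOD tower entry, after the dual-slot identification `Ψ`, Q4).

* §1 `DVRSetting.scalarMapH1_mem_atLevel_cond` — the local conditions `𝓕(n)_{j,v}` are `R`-stable (Def. 1.1.1 `cond_smul` off `n`,
  `scalarMapH1_mem_transverseCondition` at `λ ∈ n`); `scalarMapH1_eq_cohomologyMap_smul` — `H¹(r•)` is `H¹` of the module map `r • id`.
* §2 **`DVRSetting.localTatePairing_scalarMapH1_left`** — `⟨H¹_v(r•) m, y⟩_v = ⟨m, H¹_v(rᴰ) y⟩_v` in `H²(K_v, μ_{n₀})` (adjoint naturality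
  of the cup product, `ContPairing.cupProduct_adjoint`; the transpose `rᴰ = pairingDualHom n₀ (ev ∘ (r•))` — x10b-p1-w8's
  `localTatePairing_transpose` pattern with `ι := r • id`), and its `ℤ/n₀`-valued form.
* §3 **`DVRSetting.towerCasselsTatePairing_balanced`** — for ANY bi-additive `P` satisfying the value clause of Q2 (`hP`):
  `P a' y = P a y'` whenever `a' = H¹(r•) a` and `y' = H¹(rᴰ) y` (the defects of the lift `r·ã` of `r·a` are `r·m_v`:
  `redLEH1_scalarMapH1`, `localization_scalarMapH1`, `cohomologyMap_scalarMapH1`, §1; then §2 termwise and `loc_v ∘ H¹(rᴰ) =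
  H¹_v(rᴰ) ∘ loc_v`).

HONEST FRAMING: Prop. 1.4.1, C45.1″ and `thm161_dvrKolyvaginBound` are NOT proved here; no summit statement is proved; BSD is not
proved by any of this.

References: [Howard2004HeegnerKolyvagin] Def. 1.1.1, Prop. 1.4.1, Thm. 1.4.2 proof (arXiv:1202.6340 p. 5 L20–21, p. 8 L83–120);
[NeukirchSchmidtWingberg2008] I §4 (1.4.2) (adjoint naturality of the cup product); [MilneADT2006] I Cor. 2.3.
-/

set_option autoImplicit false

noncomputable section

namespace Literature.NumberTheory.GaloisCohomology.Howard2004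

open Function NumberField IsDedekindDomain Field CategoryTheory
open scoped NumberField ContRepresentation
open Literature.NumberTheory.GaloisRepresentations
open Literature.NumberTheory.GaloisRepresentations.DiscreteGaloisModule
open Literature.NumberTheory.GaloisRepresentations.galoisCohomology
open Literature.NumberTheory.GaloisCohomology (LocalInvariants)

namespace DVRSetting

variable {p : ℕ} [Fact p.Prime] {K : Type} [Field K] [NumberField K]
  {R : Type} [CommRing R] [IsDomain R] [IsDiscreteValuationRing R] [Algebra ℤ_[p] R]
  {N : ℕ → Type} [∀ k, AddCommGroup (N k)] [∀ k, TopologicalSpace (N k)]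
  [∀ k, DiscreteTopology (N k)] [∀ k, Module R (N k)]
  {Rk : ℕ → Type} [∀ k, CommRing (Rk k)] [∀ k, IsLocalRing (Rk k)] [∀ k, TopologicalSpace (Rk k)]
  [∀ k, DiscreteTopology (Rk k)] [∀ k, Algebra ℤ_[p] (Rk k)] [∀ k, Algebra R (Rk k)]
  [∀ k, Module (Rk k) (N k)] [∀ k, IsScalarTower R (Rk k) (N k)]
  {Nbar : Type} [AddCommGroup Nbar] [TopologicalSpace Nbar] [DiscreteTopology Nbar]
  [∀ k, Module (Rk k) Nbar]
  {Nq : ℕ → Finset (HeightOneSpectrum (𝓞 K)) → Type} [∀ k n, AddCommGroup (Nq k n)]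
  [∀ k n, TopologicalSpace (Nq k n)] [∀ k n, DiscreteTopology (Nq k n)]
  [∀ k n, Module (Rk k) (Nq k n)] [∀ k n, Module R (Nq k n)]
  [∀ k n, IsScalarTower R (Rk k) (Nq k n)]

/-! ## §1 `R`-stability of the level conditions; `H¹(r•)` as `H¹` of a module map -/

/-- **`𝓕(n)_{j,v}` is an `R`-submodule at every place** (Def. 1.1.1; off `n`: `cond_smul`; at `λ ∈ n` the transverse condition is
`R`-stable). [cite: Howard2004HeegnerKolyvagin, Def. 1.1.1 and Def. 1.2.2 (arXiv:1202.6340 p. 5 L20–21, p. 6 L101–125)] -/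
theorem scalarMapH1_mem_atLevel_cond (S : DVRSetting p K R N Rk Nbar Nq) (hy : S.SatisfiesH) (j : ℕ)
    (n : Finset (HeightOneSpectrum (𝓞 K))) (v : Place K) (r : R) {x : galoisCohomology ((S.T.ρ j).toLocal v) 1}
    (hx : x ∈ ((S.t j).atLevel S.jbar n).cond v) :
    scalarMapH1 ((S.T.ρ j).toLocal v) ((S.T.hlin j).restrictField (Place.Completion v)) r x ∈
      ((S.t j).atLevel S.jbar n).cond v := by
  rcases v with w | w
  · rw [(S.t j).atLevel_cond_inl] at hx ⊢
    exact hy.cond_smul j (Sum.inl w) r ⟨x, hx, rfl⟩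
  · by_cases hw : w ∈ n
    · rw [(S.t j).atLevel_cond_inr_of_mem S.jbar hw] at hx ⊢
      exact scalarMapH1_mem_transverseCondition p (S.T.hlin j) _ S.jbar w r hx
    · rw [(S.t j).atLevel_cond_inr_of_not_mem S.jbar hw] at hx ⊢
      exact hy.cond_smul j (Sum.inr w) r ⟨x, hx, rfl⟩

omit [IsDomain R] [IsDiscreteValuationRing R] in
/-- **`H¹(r•) = H¹(r • id)`**: the scalar action on `H¹` is the map induced by the equivariant module endomorphism `r • id`
(both are `[φ] ↦ [r • φ]` on cocycles). [cite: SerreGaloisCohomology1997, Ch. I §2.2 and §5.1] -/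
theorem scalarMapH1_eq_cohomologyMap_smul {L : Type} [Field L] {M : Type} [AddCommGroup M] [TopologicalSpace M]
    [DiscreteTopology M] [Module R M] (τ : DiscreteGaloisModule L M) (hτ : τ.IsScalarLinear R) (r : R)
    (c : galoisCohomology τ 1) :
    scalarMapH1 τ hτ r c =
      ContinuousRep.cohomologyMap τ τ (r • (LinearMap.id : M →ₗ[R] M)).toAddMonoidHom continuous_of_discreteTopology
        (fun g x => by
          change r • τ g x = τ g (r • x)
          exact (hτ g r x).symm) 1 c := by
  obtain ⟨z, rfl⟩ := oneCocycleClass_surjective τ.toTopRep c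
  rw [scalarMapH1_oneCocycleClass, cohomologyMap_one_oneCocycleClass]
  refine congrArg _ (Subtype.ext (ContinuousMap.ext fun g => ?_))
  rw [scalarCocycle_apply, contOneCocycles.pullback_apply]
  rfl

/-! ## §2 Adjointness of `r` and its transpose `rᴰ` under the local Tate pairing -/

/-- The pairing `B_r(x, f) = f(r x) : N_0 × N_0^∨(1) → μ_{n₀}` is `Γ_K`-equivariant. [cite: MilneADT2006, Ch. I §2 (the evaluation pairing)] -/
theorem pairing_smul_transpose_smul [Finite (N 0)] (S : DVRSetting p K R N Rk Nbar Nq) (n₀ : ℕ) (r : R)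
    (σ : absoluteGaloisGroup K) (x : N 0) (f : TateDual K (N 0) n₀) :
    ((tateDualEval K (N 0) n₀).comp (r • (LinearMap.id : N 0 →ₗ[R] N 0)).toAddMonoidHom) (S.T.ρ 0 σ x)
        ((S.T.ρ 0).tateDual n₀ σ f) =
      mu K n₀ σ (((tateDualEval K (N 0) n₀).comp (r • (LinearMap.id : N 0 →ₗ[R] N 0)).toAddMonoidHom) x f) := by
  change tateDualEval K (N 0) n₀ (r • S.T.ρ 0 σ x) ((S.T.ρ 0).tateDual n₀ σ f) =
    mu K n₀ σ (tateDualEval K (N 0) n₀ (r • x) f)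
  rw [← S.T.hlin 0 σ r x]
  exact tateDualEval_smul (S.T.ρ 0) n₀ σ (r • x) f

/-- **`⟨H¹_v(r•) m, y⟩_v = ⟨m, H¹_v(rᴰ) y⟩_v` in `H²(K_v, μ_{n₀})`** for `m ∈ H¹(K_v, N_0)`, `y ∈ H¹(K_v, N_0^∨(1))`: the scalar `r` and
its transpose `rᴰ = pairingDualHom n₀ (ev ∘ (r•))` (`f ↦ f ∘ (r•)`) are adjoint under the local Tate pairing (adjoint naturality
of the cup product). [cite: NeukirchSchmidtWingberg2008, I §4 (1.4.2)] [cite: MilneADT2006, Ch. I Cor. 2.3] -/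
theorem localTatePairing_scalarMapH1_left [Finite (N 0)] (S : DVRSetting p K R N Rk Nbar Nq) (n₀ : ℕ) (r : R)
    (v : Place K) (m : galoisCohomology ((S.T.ρ 0).toLocal v) 1)
    (y : galoisCohomology (((S.T.ρ 0).tateDual n₀).toLocal v) 1) :
    localTatePairing (S.T.ρ 0) n₀ v
        (scalarMapH1 ((S.T.ρ 0).toLocal v) ((S.T.hlin 0).restrictField (Place.Completion v)) r m) y =
      localTatePairing (S.T.ρ 0) n₀ v m
        (ContinuousRep.cohomologyMap (((S.T.ρ 0).tateDual n₀).toLocal v) (((S.T.ρ 0).tateDual n₀).toLocal v)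
          (pairingDualHom n₀ ((tateDualEval K (N 0) n₀).comp (r • (LinearMap.id : N 0 →ₗ[R] N 0)).toAddMonoidHom))
          continuous_of_discreteTopology (fun _ f => pairingDualHom_smul (S.pairing_smul_transpose_smul n₀ r) _ f) 1 y) := by
  haveI : CompactSpace (absoluteGaloisGroup (Place.Completion v)) := absoluteGaloisGroup_compactSpace _
  rw [scalarMapH1_eq_cohomologyMap_smul]
  exact ContPairing.cupProduct_adjoint (tateDualPairingLocal (S.T.ρ 0) n₀ v) (tateDualPairingLocal (S.T.ρ 0) n₀ v)
    (TopRep.ofHom ⟨⟨(r • (LinearMap.id : N 0 →ₗ[R] N 0)).toAddMonoidHom.toIntLinearMap, continuous_of_discreteTopology⟩,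
      fun g => ContinuousLinearMap.ext fun x => by
        change r • (S.T.ρ 0).toLocal v g x = (S.T.ρ 0).toLocal v g (r • x)
        exact ((S.T.hlin 0).restrictField (Place.Completion v) g r x).symm⟩)
    (TopRep.ofHom ⟨⟨(pairingDualHom n₀ ((tateDualEval K (N 0) n₀).comp
        (r • (LinearMap.id : N 0 →ₗ[R] N 0)).toAddMonoidHom)).toIntLinearMap, continuous_of_discreteTopology⟩,
      fun g => ContinuousLinearMap.ext fun f => pairingDualHom_smul (S.pairing_smul_transpose_smul n₀ r) _ f⟩)
    (fun _ _ => rfl) m y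

/-- The same in `ℤ/n₀` after any additive `inv_v : H²(K_v, μ_{n₀}) → ℤ/n₀`. [cite: MilneADT2006, Ch. I Cor. 2.3] -/
theorem localTatePairingZMod_scalarMapH1_left [Finite (N 0)] (S : DVRSetting p K R N Rk Nbar Nq) (n₀ : ℕ) (r : R)
    (v : Place K) (inv : galoisCohomology ((mu K n₀).toLocal v) 2 →+ ZMod n₀)
    (m : galoisCohomology ((S.T.ρ 0).toLocal v) 1) (y : galoisCohomology (((S.T.ρ 0).tateDual n₀).toLocal v) 1) :
    localTatePairingZMod (S.T.ρ 0) n₀ v inv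
        (scalarMapH1 ((S.T.ρ 0).toLocal v) ((S.T.hlin 0).restrictField (Place.Completion v)) r m) y =
      localTatePairingZMod (S.T.ρ 0) n₀ v inv m
        (ContinuousRep.cohomologyMap (((S.T.ρ 0).tateDual n₀).toLocal v) (((S.T.ρ 0).tateDual n₀).toLocal v)
          (pairingDualHom n₀ ((tateDualEval K (N 0) n₀).comp (r • (LinearMap.id : N 0 →ₗ[R] N 0)).toAddMonoidHom))
          continuous_of_discreteTopology (fun _ f => pairingDualHom_smul (S.pairing_smul_transpose_smul n₀ r) _ f) 1 y) := by
  change inv (localTatePairing (S.T.ρ 0) n₀ v _ y) = inv (localTatePairing (S.T.ρ 0) n₀ v m _)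
  rw [S.localTatePairing_scalarMapH1_left n₀ r v m y]

/-! ## §3 The pairing is `R`-balanced -/

/-- **`P(r·a, y) = P(a, rᴰ·y)`** for any bi-additive `P` on `H¹_{𝓕(n)}(K, T^{(i)}) × H¹_{𝓕(n)_0^*}(K, N_0^∨(1))` with the VALUE CLAUSE of the
class-level Cassels–Tate pairing (`TowerCasselsTatePairingOfDefectsProofs.exists_towerCasselsTatePairing`): if `a' = H¹(r•) a` and
`y' = H¹(rᴰ) y` (`rᴰ` the precomposition by `r•` on the Tate dual), then `P a' y = P a y'`.  With a global lift `ã` of `a` and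
defects `m_v` on a finite `Σ` (they exist: `hlift`, the local Selmer lifts under `p ∤ #𝓞_K^×`, the finite exceptional set), the
class `r·ã` lifts `a'` (`redLEH1_scalarMapH1`) with defects `r·m_v` on the same `Σ` (`localization_scalarMapH1`,
`cohomologyMap_scalarMapH1`, `R`-stability of `𝓕(n)_{t+1,v}`), so `P a' y = Σ_v ⟨r·m_v, y_v⟩ = Σ_v ⟨m_v, rᴰ y_v⟩ = P a y'`.
[cite: Howard2004HeegnerKolyvagin, Prop. 1.4.1 and Thm. 1.4.2 proof (arXiv:1202.6340 p. 8 L83–120: «pairing of R/𝔪-vector spaces»)]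
[cite: NeukirchSchmidtWingberg2008, I §4 (1.4.2)] -/
theorem towerCasselsTatePairing_balanced (S : DVRSetting p K R N Rk Nbar Nq) [Finite (N 0)] (hy : S.SatisfiesH)
    (hu : ¬ p ∣ Nat.card (𝓞 K)ˣ) {i t : ℕ} (hit : i ≤ t + 1) {n : Finset (HeightOneSpectrum (𝓞 K))}
    (hn : ↑n ⊆ S.levelPrimes (t + 1)) (ι : N 0 →ₗ[R] N (t + 1))
    (hιg : ∀ (g : absoluteGaloisGroup K) (x : N 0), ι (S.T.ρ 0 g x) = S.T.ρ (t + 1) g (ι x))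
    (hιinj : Function.Injective ι) (hιex : ∀ y : N (t + 1), S.T.redLE hit y = 0 ↔ ∃ x, ι x = y)
    {n₀ : ℕ} [NeZero n₀] (inv : LocalInvariants K n₀)
    (hlift : ∀ a ∈ (((S.t i).atLevel S.jbar n).cond).selmerGroup,
      ∃ ã : galoisCohomology (S.T.ρ (t + 1)) 1, S.redLEH1 hit ã = a)
    (P : ↥(((S.t i).atLevel S.jbar n).cond).selmerGroup →+
        ↥(inv.dualSelmerStructure (S.T.ρ 0) ((S.t 0).atLevel S.jbar n).cond).selmerGroup →+ ZMod n₀)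
    (hP : ∀ (a : ↥(((S.t i).atLevel S.jbar n).cond).selmerGroup) (ã : galoisCohomology (S.T.ρ (t + 1)) 1)
        (_ : S.redLEH1 hit ã = a) (m : ∀ v : Place K, galoisCohomology ((S.T.ρ 0).toLocal v) 1)
        (_ : ∀ v, ∃ ℓ ∈ ((S.t (t + 1)).atLevel S.jbar n).cond v,
          galoisCohomology.localization (S.T.ρ (t + 1)) v 1 ã - ℓ =
            ContinuousRep.cohomologyMap ((S.T.ρ 0).toLocal v) ((S.T.ρ (t + 1)).toLocal v) ι.toAddMonoidHom
              continuous_of_discreteTopology (fun _ x => hιg _ x) 1 (m v))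
        (Sfin : Finset (Place K)) (_ : ∀ v ∉ Sfin, m v = 0)
        (y : ↥(inv.dualSelmerStructure (S.T.ρ 0) ((S.t 0).atLevel S.jbar n).cond).selmerGroup),
        P a y = ∑ v ∈ Sfin, localTatePairingZMod (S.T.ρ 0) n₀ v (inv v) (m v)
          (galoisCohomology.localization ((S.T.ρ 0).tateDual n₀) v 1 y))
    (r : R) (a a' : ↥(((S.t i).atLevel S.jbar n).cond).selmerGroup)
    (ha' : (a' : galoisCohomology (S.T.ρ i) 1) = scalarMapH1 (S.T.ρ i) (S.T.hlin i) r (a : galoisCohomology (S.T.ρ i) 1))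
    (y y' : ↥(inv.dualSelmerStructure (S.T.ρ 0) ((S.t 0).atLevel S.jbar n).cond).selmerGroup)
    (hy' : (y' : galoisCohomology ((S.T.ρ 0).tateDual n₀) 1) =
      ContinuousRep.cohomologyMap ((S.T.ρ 0).tateDual n₀) ((S.T.ρ 0).tateDual n₀)
        (pairingDualHom n₀ ((tateDualEval K (N 0) n₀).comp (r • (LinearMap.id : N 0 →ₗ[R] N 0)).toAddMonoidHom))
        continuous_of_discreteTopology (pairingDualHom_smul (S.pairing_smul_transpose_smul n₀ r)) 1
        (y : galoisCohomology ((S.T.ρ 0).tateDual n₀) 1)) :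
    P a' y = P a y' := by
  classical
  -- data for `a`: a global lift, a finite set, defects
  obtain ⟨ã, hã⟩ := hlift a.1 a.2
  obtain ⟨Sfin, -, -, hout⟩ := S.exists_finset_forall_localization_mem_atLevel_cond (t + 1) n ã
  obtain ⟨m, hm, hmS⟩ := S.exists_localDefects_of_forall_exists_redLELoc_eq hit n ι hιg hιinj hιex ã Sfin
    (fun v _ => S.exists_mem_atLevel_cond_redLELoc_eq_redLELoc_localization hy hu hit hn (hã ▸ a.2) v) hout
  -- data for `a' = r·a`: the lift `r·ã` with defects `r·m_v` on the same `Σ`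
  let ιL : ∀ v : Place K, galoisCohomology ((S.T.ρ 0).toLocal v) 1 →+ galoisCohomology ((S.T.ρ (t + 1)).toLocal v) 1 :=
    fun v => ContinuousRep.cohomologyMap ((S.T.ρ 0).toLocal v) ((S.T.ρ (t + 1)).toLocal v) ι.toAddMonoidHom
      continuous_of_discreteTopology (fun _ x => hιg _ x) 1
  have hã' : S.redLEH1 hit (scalarMapH1 (S.T.ρ (t + 1)) (S.T.hlin (t + 1)) r ã) = a' := by
    rw [S.redLEH1_scalarMapH1 hit r ã, hã, ← ha']
  have hm' : ∀ v, ∃ ℓ ∈ ((S.t (t + 1)).atLevel S.jbar n).cond v,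
      galoisCohomology.localization (S.T.ρ (t + 1)) v 1 (scalarMapH1 (S.T.ρ (t + 1)) (S.T.hlin (t + 1)) r ã) - ℓ =
        ιL v (scalarMapH1 ((S.T.ρ 0).toLocal v) ((S.T.hlin 0).restrictField (Place.Completion v)) r (m v)) := by
    intro v
    obtain ⟨ℓ, hℓ, hℓeq⟩ := hm v
    refine ⟨scalarMapH1 ((S.T.ρ (t + 1)).toLocal v) ((S.T.hlin (t + 1)).restrictField (Place.Completion v)) r ℓ,
      S.scalarMapH1_mem_atLevel_cond hy (t + 1) n v r hℓ, ?_⟩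
    have hι : ιL v (scalarMapH1 ((S.T.ρ 0).toLocal v) ((S.T.hlin 0).restrictField (Place.Completion v)) r (m v)) =
        scalarMapH1 ((S.T.ρ (t + 1)).toLocal v) ((S.T.hlin (t + 1)).restrictField (Place.Completion v)) r (ιL v (m v)) :=
      cohomologyMap_scalarMapH1 ((S.T.hlin 0).restrictField (Place.Completion v))
        ((S.T.hlin (t + 1)).restrictField (Place.Completion v)) ι (fun _ x => hιg _ x) r (m v)
    rw [galoisCohomology.localization_scalarMapH1, hι, ← map_sub]
    exact congrArg _ hℓeq
  have hmS' : ∀ v ∉ Sfin, scalarMapH1 ((S.T.ρ 0).toLocal v) ((S.T.hlin 0).restrictField (Place.Completion v)) r (m v) = 0 :=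
    fun v hv => by rw [hmS v hv, map_zero]
  rw [hP a ã hã m hm Sfin hmS y', hP a' _ hã' _ hm' Sfin hmS' y]
  refine Finset.sum_congr rfl fun v _ => ?_
  rw [S.localTatePairingZMod_scalarMapH1_left n₀ r v (inv v) (m v), hy', localization_cohomologyMap_one]

end DVRSetting

end Literature.NumberTheory.GaloisCohomology.Howard2004

end
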